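import Literature.NumberTheory.EllipticCurves.KleinJCuspExpansion
import HarnessLib

/-!
# Klein's invariant near the cusp on the wider disc `‖q‖ ≤ 10⁻³`: `‖j(τ) − 1/q − 744‖ ≤ 5.25·10⁵‖q‖`

certified instances and evidence bearing on the general Hodge conjecture; no claim.

Topic `NumberTheory/EllipticCurves` (level-one modular forms); theorem-only file (no definition, no named fact;
D-0026), everything **proved**.  The tree's `KleinJCuspExpansion.lean` proves the first-order cusp estimate
`‖E₄³/Δ − 1/q − 744‖ ≤ 4·10⁵‖q‖` (`Literature.NumberTheory.EllipticCurves.ModularForms.norm_E₄_cube_div_discriminant_sub_sub_le`)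
under the hypothesis `‖q‖ ≤ 10⁻⁴`, which covers the CM points `τ_Q`, `Q = (a, b, c)`, with `e^{−π√|D|/a} ≤ 10⁻⁴`.
The singular moduli of the non-principal forms `(2,0,3)` of discriminant `−24` (`|q| = e^{−π√6} ≈ 4.55·10⁻⁴`) and
`(3,3,5)` of discriminant `−51` (`|q| = e^{−π√51/3} ≈ 5.65·10⁻⁴`) lie outside that disc.  This file re-derives the
same estimate, by the same architecture and reusing that file's `q`-series lemmas (`E₄_eq_tsum`,
`summable_sigma_mul_qParam_pow`, `sigma_three_le_sixteen_pow`, `summable_log_one_sub_pow`,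
`cexp_tsum_log_one_sub_pow`), on the WIDER disc `‖q‖ ≤ 10⁻³`, with the `r`-dependent numeric side conditions
re-done for `r = ‖q‖ ≤ 10⁻³` (constants OURS; exact-rational bookkeeping at `r = 10⁻³`, each bound monotone in `r`):

* `…ModularForms.norm_E₄_sub_sub_le_wide` : `‖E₄(τ) − 1 − 240q‖ ≤ 62500‖q‖²`
  (`(1 − 16r)⁻¹ ≤ 1.017`, `240·256·1.017 = 62484.48`);
* `…ModularForms.norm_E₄_cube_sub_sub_le_wide` : `‖E₄(τ)³ − 1 − 720q‖ ≤ 4.9·10⁵‖q‖²`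
  (`‖E₄ − 1‖ ≤ 302.5r`, `3·62500 + 3·302.5² + 302.5³·10⁻³ = 489699.4`);
* `…ModularForms.norm_tsum_log_one_sub_pow_add_le_wide` : `‖Σ_{n≥1} log(1 − qⁿ) + q‖ ≤ 2‖q‖²` (as at `10⁻⁴`;
  `(1 − r)⁻¹/2 ≤ 0.5006`, `(1 − r)⁻¹, (1 − r²)⁻¹ ≤ 1.002`, total `1.5036`);
* `…ModularForms.norm_inv_tprod_sub_sub_le_wide` : `‖(∏(1 − qⁿ)²⁴)⁻¹ − 1 − 24q‖ ≤ 630‖q‖²`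
  (`‖24q + δ‖ ≤ 24.048r ≤ 1`, `24.048² + 48 = 626.3`);
* `…ModularForms.norm_E₄_cube_div_discriminant_sub_sub_le_wide` : **`‖E₄³/Δ − 1/q − 744‖ ≤ 5.25·10⁵‖q‖`**
  for `‖q‖ ≤ 10⁻³` (`17280 + 490000(1 + 24r + 630r²) + 630(1 + 720r) = 520432.3` at `r = 10⁻³`).

PRINTED: the `q`-expansions `E₄ = 1 + 240 Σ σ₃(n)qⁿ`, `Δ = q ∏ (1 − qⁿ)²⁴`, `j = 1/q + 744 + 196884q + 21493760q² + ⋯`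
(Cox, Thm. 11.8 and §13.B; Serre VII §4).  OURS: the explicit error constants (crude: the true coefficient of `q` is
`196884`).  LIMITS: theorem-only Literature lemma — first-order cusp estimate on `‖q‖ ≤ 10⁻³` (constants ours),
widening the tree's `10⁻⁴` lemma; reusable for level-2/3 class-polynomial pins; nothing about HC.

## References

* D. A. Cox, *Primes of the form x² + ny²*, 2nd ed., Wiley 2013, §11.A Thm. 11.8 (`j = 1/q + 744 + 196884q + ⋯`,
  PDF p. 235), §13.B (`g₂`, `Δ`, `j` expansions, PDF p. 297). [Cox2013]
* J.-P. Serre, *A Course in Arithmetic*, GTM 7, Springer 1973, VII §3.3 and §4. [Serre1973]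
-/

noncomputable section

open Complex Filter Topology ArithmeticFunction
open UpperHalfPlane hiding I
open scoped Real

namespace Literature.NumberTheory.EllipticCurves.ModularForms

/-! ### The `q`-expansion of `E₄` near the cusp, `‖q‖ ≤ 10⁻³` -/

/-- **`E₄` near the cusp, wide disc**: for `‖q‖ ≤ 10⁻³`, `‖E₄(τ) − 1 − 240q‖ ≤ 62500‖q‖²`
(the tail `240 Σ_{n ≥ 2} σ₃(n)qⁿ` with `σ₃(n) ≤ 16ⁿ`; constant ours).
[cite: Cox2013, §13.B (`g₂(τ) = (2π)⁴/12 · (1 + 240 Σ σ₃(n) qⁿ)`, PDF p. 297)] -/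
theorem norm_E₄_sub_sub_le_wide (τ : ℍ) (hq : ‖Function.Periodic.qParam 1 (τ : ℂ)‖ ≤ 1 / 10 ^ 3) :
    ‖ModularForm.E₄ τ - 1 - 240 * Function.Periodic.qParam 1 (τ : ℂ)‖ ≤
      62500 * ‖Function.Periodic.qParam 1 (τ : ℂ)‖ ^ 2 := by
  set q := Function.Periodic.qParam 1 (τ : ℂ) with hqdef
  set r := ‖q‖ with hr
  have hr0 : 0 ≤ r := norm_nonneg _
  have hr1 : r ≤ 1 / 10 ^ 3 := hq
  have hs := summable_sigma_mul_qParam_pow τ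
  have hs1 : Summable fun n : ℕ ↦ (sigma 3 (n + 1) : ℂ) * q ^ (n + 1) :=
    (summable_nat_add_iff (f := fun n : ℕ ↦ (sigma 3 n : ℂ) * q ^ n) 1).mpr hs
  have hs2 : Summable fun n : ℕ ↦ (sigma 3 (n + 2) : ℂ) * q ^ (n + 2) :=
    (summable_nat_add_iff (f := fun n : ℕ ↦ (sigma 3 n : ℂ) * q ^ n) 2).mpr hs
  -- split off the first term `σ₃(1) q = q`
  have hsplit : ∑' n : ℕ, (sigma 3 (n + 1) : ℂ) * q ^ (n + 1) =
      q + ∑' n : ℕ, (sigma 3 (n + 2) : ℂ) * q ^ (n + 2) := by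
    rw [hs1.tsum_eq_zero_add]
    simp only [zero_add, sigma_one, Nat.cast_one, one_mul, pow_one]
  have hE : ModularForm.E₄ τ - 1 - 240 * q = 240 * ∑' n : ℕ, (sigma 3 (n + 2) : ℂ) * q ^ (n + 2) := by
    rw [E₄_eq_tsum, ← hqdef, hsplit]; ring
  -- the tail is bounded by the geometric series `Σ (16 r)^{n+2}`
  have h16 : 16 * r < 1 := by nlinarith
  have hgeom : HasSum (fun n : ℕ ↦ (16 * r) ^ 2 * (16 * r) ^ n) ((16 * r) ^ 2 * (1 - 16 * r)⁻¹) :=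
    (hasSum_geometric_of_lt_one (by positivity) h16).mul_left _
  have htail : ‖∑' n : ℕ, (sigma 3 (n + 2) : ℂ) * q ^ (n + 2)‖ ≤ (16 * r) ^ 2 * (1 - 16 * r)⁻¹ := by
    refine tsum_of_norm_bounded hgeom fun n ↦ ?_
    rw [norm_mul, norm_pow, Complex.norm_natCast, ← hr,
      show (16 * r) ^ 2 * (16 * r) ^ n = 16 ^ (n + 2) * r ^ (n + 2) by ring]
    exact mul_le_mul_of_nonneg_right (sigma_three_le_sixteen_pow (n + 2)) (pow_nonneg hr0 _)
  rw [hE, norm_mul, show ‖(240 : ℂ)‖ = 240 by norm_num]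
  have hinv : (1 - 16 * r)⁻¹ ≤ 1017 / 1000 := by
    rw [inv_le_comm₀ (by linarith) (by norm_num)]
    nlinarith
  calc 240 * ‖∑' n : ℕ, (sigma 3 (n + 2) : ℂ) * q ^ (n + 2)‖
      ≤ 240 * ((16 * r) ^ 2 * (1 - 16 * r)⁻¹) := by gcongr
    _ ≤ 240 * ((16 * r) ^ 2 * (1017 / 1000)) := by gcongr
    _ ≤ 62500 * r ^ 2 := by nlinarith

/-- **`E₄³` near the cusp, wide disc**: for `‖q‖ ≤ 10⁻³`, `‖E₄(τ)³ − 1 − 720q‖ ≤ 490000‖q‖²` (constant ours).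
[cite: Cox2013, §13.B (`g₂`, `Δ` and `j` expansions, PDF p. 297)] -/
theorem norm_E₄_cube_sub_sub_le_wide (τ : ℍ) (hq : ‖Function.Periodic.qParam 1 (τ : ℂ)‖ ≤ 1 / 10 ^ 3) :
    ‖ModularForm.E₄ τ ^ 3 - 1 - 720 * Function.Periodic.qParam 1 (τ : ℂ)‖ ≤
      490000 * ‖Function.Periodic.qParam 1 (τ : ℂ)‖ ^ 2 := by
  set q := Function.Periodic.qParam 1 (τ : ℂ) with hqdef
  set r := ‖q‖ with hr
  have hr0 : 0 ≤ r := norm_nonneg _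
  have hr1 : r ≤ 1 / 10 ^ 3 := hq
  set ε := ModularForm.E₄ τ - 1 - 240 * q with hεdef
  set u := ModularForm.E₄ τ - 1 with hudef
  have hε : ‖ε‖ ≤ 62500 * r ^ 2 := norm_E₄_sub_sub_le_wide τ hq
  have hu : ‖u‖ ≤ 3025 / 10 * r := by
    have h1 : u = 240 * q + ε := by simp only [hεdef, hudef]; ring
    calc ‖u‖ = ‖240 * q + ε‖ := by rw [h1]
      _ ≤ ‖(240 : ℂ) * q‖ + ‖ε‖ := norm_add_le _ _
      _ = 240 * r + ‖ε‖ := by rw [norm_mul, hr]; norm_num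
      _ ≤ 240 * r + 62500 * r ^ 2 := by linarith
      _ ≤ 3025 / 10 * r := by nlinarith
  have hid : ModularForm.E₄ τ ^ 3 - 1 - 720 * q = 3 * ε + 3 * u ^ 2 + u ^ 3 := by
    simp only [hεdef, hudef]; ring
  rw [hid]
  have hu0 : 0 ≤ ‖u‖ := norm_nonneg _
  have hu3 : ‖u‖ ^ 3 ≤ (3025 / 10 * r) ^ 3 := by gcongr
  have hr3 : (3025 / 10 * r) ^ 3 ≤ (3025 / 10) ^ 3 / 10 ^ 3 * r ^ 2 := by
    have h : r ^ 3 ≤ 1 / 10 ^ 3 * r ^ 2 := by nlinarith [sq_nonneg r]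
    nlinarith
  calc ‖3 * ε + 3 * u ^ 2 + u ^ 3‖ ≤ ‖3 * ε‖ + ‖3 * u ^ 2‖ + ‖u ^ 3‖ := norm_add₃_le
    _ = 3 * ‖ε‖ + 3 * ‖u‖ ^ 2 + ‖u‖ ^ 3 := by simp [norm_pow]
    _ ≤ 3 * (62500 * r ^ 2) + 3 * (3025 / 10 * r) ^ 2 + (3025 / 10) ^ 3 / 10 ^ 3 * r ^ 2 := by
        gcongr ?_ + ?_ + ?_
        · exact mul_le_mul_of_nonneg_left hε (by norm_num)
        · exact mul_le_mul_of_nonneg_left (by gcongr) (by norm_num)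
        · exact hu3.trans hr3
    _ ≤ 490000 * r ^ 2 := by nlinarith [sq_nonneg r]

/-! ### The Euler product `∏ (1 − qⁿ)` near `q = 0`, `‖q‖ ≤ 10⁻³` -/

/-- **First-order expansion of `log ∏ (1 − qⁿ)`, wide disc**: for `‖q‖ ≤ 10⁻³`,
`‖Σ_{n ≥ 1} log(1 − qⁿ) + q‖ ≤ 2‖q‖²` (same statement as the tree's `10⁻⁴` lemma, hypothesis widened; constants ours).
[cite: Cox2013, §13.B (`Δ(τ) = (2π)¹² q ∏ (1 − qⁿ)²⁴`, PDF p. 297)] -/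
theorem norm_tsum_log_one_sub_pow_add_le_wide {q : ℂ} (hq : ‖q‖ ≤ 1 / 10 ^ 3) :
    ‖∑' n : ℕ, Complex.log (1 - q ^ (n + 1)) + q‖ ≤ 2 * ‖q‖ ^ 2 := by
  set r := ‖q‖ with hr
  have hr0 : 0 ≤ r := norm_nonneg _
  have hr1 : r ≤ 1 / 10 ^ 3 := hq
  have hq1 : ‖q‖ < 1 := by rw [← hr]; linarith
  -- the pieces
  set a : ℕ → ℂ := fun n ↦ Complex.log (1 - q ^ (n + 1)) + q ^ (n + 1) with ha
  have hg : Summable fun n : ℕ ↦ q ^ n := summable_geometric_of_norm_lt_one hq1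
  have hg1 : Summable fun n : ℕ ↦ q ^ (n + 1) := (summable_nat_add_iff (f := fun n ↦ q ^ n) 1).mpr hg
  have hg2 : Summable fun n : ℕ ↦ q ^ (n + 2) := (summable_nat_add_iff (f := fun n ↦ q ^ n) 2).mpr hg
  have hsa : Summable a := (summable_log_one_sub_pow hq1).add hg1
  have hdecomp : ∑' n : ℕ, Complex.log (1 - q ^ (n + 1)) + q =
      ∑' n, a n - ∑' n : ℕ, q ^ (n + 2) := by
    have h1 : ∑' n : ℕ, Complex.log (1 - q ^ (n + 1)) = ∑' n, a n - ∑' n : ℕ, q ^ (n + 1) := by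
      rw [← hsa.tsum_sub hg1]
      exact tsum_congr fun n ↦ by simp [ha]
    have h2 : ∑' n : ℕ, q ^ (n + 1) = q + ∑' n : ℕ, q ^ (n + 2) := by
      rw [hg1.tsum_eq_zero_add]
      simp only [zero_add, pow_one]
    rw [h1, h2]; ring
  -- bound on `Σ a`
  have hr2 : r ^ 2 < 1 := by nlinarith
  have hc : (1 - r)⁻¹ / 2 ≤ 5006 / 10000 := by
    rw [div_le_iff₀ (by norm_num : (0:ℝ) < 2), inv_le_comm₀ (by linarith) (by norm_num)]
    linarith
  have hgeomA : HasSum (fun n : ℕ ↦ (5006 / 10000 * r ^ 2) * (r ^ 2) ^ n)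
      ((5006 / 10000 * r ^ 2) * (1 - r ^ 2)⁻¹) :=
    (hasSum_geometric_of_lt_one (by positivity) hr2).mul_left _
  have hA : ‖∑' n, a n‖ ≤ (5006 / 10000 * r ^ 2) * (1 - r ^ 2)⁻¹ := by
    refine tsum_of_norm_bounded hgeomA fun n ↦ ?_
    have hqn : ‖-q ^ (n + 1)‖ < 1 := by
      rw [norm_neg, norm_pow]
      exact pow_lt_one₀ hr0 hq1 (Nat.succ_ne_zero n)
    have h1 := Complex.norm_log_one_add_sub_self_le hqn
    have h2 : a n = Complex.log (1 + -q ^ (n + 1)) - -q ^ (n + 1) := by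
      simp only [ha, sub_eq_add_neg, neg_neg]
    rw [h2]
    refine h1.trans ?_
    rw [norm_neg, norm_pow, ← hr]
    have hrn : r ^ (n + 1) ≤ r := by
      calc r ^ (n + 1) ≤ r ^ 1 := pow_le_pow_of_le_one hr0 (by linarith) (by omega)
        _ = r := pow_one r
    have hrn0 : 0 ≤ r ^ (n + 1) := pow_nonneg hr0 _
    have hinv : (1 - r ^ (n + 1))⁻¹ ≤ (1 - r)⁻¹ := by
      gcongr
    calc (r ^ (n + 1)) ^ 2 * (1 - r ^ (n + 1))⁻¹ / 2
        ≤ (r ^ (n + 1)) ^ 2 * (1 - r)⁻¹ / 2 := by gcongr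
      _ = ((1 - r)⁻¹ / 2) * (r ^ 2 * (r ^ 2) ^ n) := by ring
      _ ≤ 5006 / 10000 * (r ^ 2 * (r ^ 2) ^ n) := by gcongr
      _ = 5006 / 10000 * r ^ 2 * (r ^ 2) ^ n := by ring
  -- bound on `Σ q^{n+2}`
  have hgeomB : HasSum (fun n : ℕ ↦ r ^ 2 * r ^ n) (r ^ 2 * (1 - r)⁻¹) :=
    (hasSum_geometric_of_lt_one hr0 hq1).mul_left _
  have hB : ‖∑' n : ℕ, q ^ (n + 2)‖ ≤ r ^ 2 * (1 - r)⁻¹ := by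
    refine tsum_of_norm_bounded hgeomB fun n ↦ ?_
    rw [norm_pow, ← hr, pow_add, mul_comm]
  have hinv1 : (1 - r)⁻¹ ≤ 1002 / 1000 := by
    rw [inv_le_comm₀ (by linarith) (by norm_num)]; linarith
  have hinv2 : (1 - r ^ 2)⁻¹ ≤ 1002 / 1000 := by
    rw [inv_le_comm₀ (by linarith) (by norm_num)]; nlinarith
  rw [hdecomp]
  calc ‖∑' n, a n - ∑' n : ℕ, q ^ (n + 2)‖ ≤ ‖∑' n, a n‖ + ‖∑' n : ℕ, q ^ (n + 2)‖ := norm_sub_le _ _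
    _ ≤ (5006 / 10000 * r ^ 2) * (1 - r ^ 2)⁻¹ + r ^ 2 * (1 - r)⁻¹ := add_le_add hA hB
    _ ≤ (5006 / 10000 * r ^ 2) * (1002 / 1000) + r ^ 2 * (1002 / 1000) := by gcongr
    _ ≤ 2 * r ^ 2 := by nlinarith

/-- **The reciprocal Euler product near `q = 0`, wide disc**: for `‖q‖ ≤ 10⁻³`,
`‖(∏ (1 − qⁿ⁺¹)²⁴)⁻¹ − 1 − 24q‖ ≤ 630‖q‖²` (constant ours).
[cite: Cox2013, §13.B (`Δ(τ) = (2π)¹² q ∏ (1 − qⁿ)²⁴`, PDF p. 297)] -/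
theorem norm_inv_tprod_sub_sub_le_wide {q : ℂ} (hq : ‖q‖ ≤ 1 / 10 ^ 3) :
    ‖(∏' n : ℕ, (1 - q ^ (n + 1)) ^ 24)⁻¹ - 1 - 24 * q‖ ≤ 630 * ‖q‖ ^ 2 := by
  set r := ‖q‖ with hr
  have hr0 : 0 ≤ r := norm_nonneg _
  have hr1 : r ≤ 1 / 10 ^ 3 := hq
  have hq1 : ‖q‖ < 1 := by rw [← hr]; linarith
  set L := ∑' n : ℕ, Complex.log (1 - q ^ (n + 1)) with hL
  have hprod : ∏' n : ℕ, (1 - q ^ (n + 1)) ^ 24 = cexp (24 * L) := by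
    rw [(ModularForm.multipliable_one_sub_pow hq1).tprod_pow, ← cexp_tsum_log_one_sub_pow hq1,
      ← Complex.exp_nat_mul]
    norm_num [hL]
  rw [hprod, ← Complex.exp_neg]
  set δ := -24 * (L + q) with hδ
  have hLq : ‖L + q‖ ≤ 2 * r ^ 2 := norm_tsum_log_one_sub_pow_add_le_wide hq
  have hδn : ‖δ‖ ≤ 48 * r ^ 2 := by
    rw [hδ, norm_mul, show ‖(-24 : ℂ)‖ = 24 by norm_num]; linarith
  set x := -(24 * L) with hx
  have hxe : x = 24 * q + δ := by simp only [hx, hδ]; ring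
  have hxn : ‖x‖ ≤ 24048 / 1000 * r := by
    rw [hxe]
    calc ‖24 * q + δ‖ ≤ ‖(24 : ℂ) * q‖ + ‖δ‖ := norm_add_le _ _
      _ = 24 * r + ‖δ‖ := by rw [norm_mul, hr]; norm_num
      _ ≤ 24 * r + 48 * r ^ 2 := by linarith
      _ ≤ 24048 / 1000 * r := by nlinarith
  have hx1 : ‖x‖ ≤ 1 := by linarith [hxn]
  have hexp := Complex.norm_exp_sub_one_sub_id_le hx1
  have hid : cexp x - 1 - 24 * q = (cexp x - 1 - x) + δ := by rw [hxe]; ring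
  rw [hid]
  calc ‖cexp x - 1 - x + δ‖ ≤ ‖cexp x - 1 - x‖ + ‖δ‖ := norm_add_le _ _
    _ ≤ ‖x‖ ^ 2 + 48 * r ^ 2 := add_le_add hexp hδn
    _ ≤ (24048 / 1000 * r) ^ 2 + 48 * r ^ 2 := by gcongr
    _ ≤ 630 * r ^ 2 := by nlinarith

/-! ### Klein's `j` near the cusp, `‖q‖ ≤ 10⁻³` -/

/-- **Klein's invariant near the cusp on the wide disc: `j = 1/q + 744 + O(q)` with an explicit constant.**  For
`τ ∈ ℍ` with `‖q‖ ≤ 10⁻³` (`q = e^{2πiτ}`), `‖E₄(τ)³/Δ(τ) − 1/q − 744‖ ≤ 5.25·10⁵ ‖q‖` (the true next term being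
`196884 q`; constant ours, the tree's `10⁻⁴` version has `4·10⁵`).  From `E₄³ = 1 + 720q + O(q²)` and
`1/∏(1 − qⁿ)²⁴ = 1 + 24q + O(q²)`. [cite: Cox2013, §11.A Thm. 11.8 (`j(τ) = 1/q + 744 + 196884q + ⋯`, PDF p. 235)] -/
theorem norm_E₄_cube_div_discriminant_sub_sub_le_wide (τ : ℍ)
    (hq : ‖Function.Periodic.qParam 1 (τ : ℂ)‖ ≤ 1 / 10 ^ 3) :
    ‖ModularForm.E₄ τ ^ 3 / ModularForm.discriminant τ - (Function.Periodic.qParam 1 (τ : ℂ))⁻¹ - 744‖ ≤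
      525000 * ‖Function.Periodic.qParam 1 (τ : ℂ)‖ := by
  set q := Function.Periodic.qParam 1 (τ : ℂ) with hqdef
  set r := ‖q‖ with hr
  have hr0 : 0 < r := norm_pos_iff.mpr (Function.Periodic.qParam_ne_zero (τ : ℂ))
  have hr1 : r ≤ 1 / 10 ^ 3 := hq
  have hq0 : q ≠ 0 := Function.Periodic.qParam_ne_zero (τ : ℂ)
  set P := ∏' n : ℕ, (1 - q ^ (n + 1)) ^ 24 with hP
  set a := ModularForm.E₄ τ ^ 3 with ha
  set ε₂ := a - 1 - 720 * q with hε₂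
  set ε₃ := P⁻¹ - 1 - 24 * q with hε₃
  have h₂ : ‖ε₂‖ ≤ 490000 * r ^ 2 := norm_E₄_cube_sub_sub_le_wide τ hq
  have h₃ : ‖ε₃‖ ≤ 630 * r ^ 2 := norm_inv_tprod_sub_sub_le_wide hq
  have hΔ : ModularForm.discriminant τ = q * P := ModularForm.discriminant_eq_q_prod τ
  have hP0 : P ≠ 0 := by
    intro h0
    exact ModularForm.discriminant_ne_zero τ (by rw [hΔ, h0, mul_zero])
  have hid : a / ModularForm.discriminant τ - q⁻¹ - 744 =
      (17280 * q ^ 2 + ε₂ * P⁻¹ + ε₃ * (1 + 720 * q)) / q := by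
    rw [hΔ]
    simp only [hε₂, hε₃]
    field_simp
    ring
  rw [hid, norm_div, ← hr, div_le_iff₀ hr0]
  have hb : ‖P⁻¹‖ ≤ 1 + 24 * r + 630 * r ^ 2 := by
    have : P⁻¹ = 1 + 24 * q + ε₃ := by simp only [hε₃]; ring
    rw [this]
    calc ‖1 + 24 * q + ε₃‖ ≤ ‖(1 : ℂ) + 24 * q‖ + ‖ε₃‖ := norm_add_le _ _
      _ ≤ ‖(1 : ℂ)‖ + ‖(24 : ℂ) * q‖ + ‖ε₃‖ := by gcongr; exact norm_add_le _ _
      _ = 1 + 24 * r + ‖ε₃‖ := by rw [norm_mul, hr]; norm_num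
      _ ≤ 1 + 24 * r + 630 * r ^ 2 := by linarith
  have hc : ‖(1 : ℂ) + 720 * q‖ ≤ 1 + 720 * r := by
    calc ‖(1 : ℂ) + 720 * q‖ ≤ ‖(1 : ℂ)‖ + ‖(720 : ℂ) * q‖ := norm_add_le _ _
      _ = 1 + 720 * r := by rw [norm_mul, hr]; norm_num
  calc ‖17280 * q ^ 2 + ε₂ * P⁻¹ + ε₃ * (1 + 720 * q)‖
      ≤ ‖(17280 : ℂ) * q ^ 2‖ + ‖ε₂ * P⁻¹‖ + ‖ε₃ * (1 + 720 * q)‖ := norm_add₃_le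
    _ = 17280 * r ^ 2 + ‖ε₂‖ * ‖P⁻¹‖ + ‖ε₃‖ * ‖(1 : ℂ) + 720 * q‖ := by
        rw [norm_mul, norm_mul, norm_mul, norm_pow, hr]; norm_num
    _ ≤ 17280 * r ^ 2 + 490000 * r ^ 2 * (1 + 24 * r + 630 * r ^ 2) +
          630 * r ^ 2 * (1 + 720 * r) := by
        gcongr
    _ = (507910 + 12213600 * r + 308700000 * r ^ 2) * r * r := by ring
    _ ≤ 525000 * r * r := by
        have h1 : 507910 + 12213600 * r + 308700000 * r ^ 2 ≤ 525000 := by nlinarith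
        have h2 : 0 ≤ r * r := by positivity
        nlinarith

end Literature.NumberTheory.EllipticCurves.ModularForms

end
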